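import Mathlib
import HarnessLib
import Summits.ValiantsHypothesis.ValiantsHypothesis.Theorems.LacunarySymmetroidMatrixDescartesProductPlusOneSixthOrderCellEveryK
import Summits.ValiantsHypothesis.ValiantsHypothesis.Theorems.LacunarySymmetroidMatrixDescartesProductPlusOneRowTowerKCloudTransferTop

/-!
# LINE (A) `product_plus_one` (crux `MatrixDescartes`, stmt-ValiantsHypothesis-18050, V1) — W-CB §30.5 C5, THE CLOUD CELL (K = 3, LINE shape):
# ★★ on a window where every CLOUD shows its isolated sign and every other row has a positive order-8 image, `W(∏_j f_j)` has AT MOST SIX roots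

`K = 3`, support `d 0 < d 1 < d 2` with `3(d1 − d0) ≤ d2 − d0` (outer gap ≥ 2 × inner = E3b's `2(e₁+1) ≤ e₂+1`); rows `f_j = Σ_l C (a j l) X^{d l}`, window
`(u,v)`, `0 < u`.  MENU (each row one of):
 (C↓) a cloud whose BOTTOM coefficient is isolated in sign (`a j 0·a j 1 < 0`, `a j 0·a j 2 < 0`, T5 `(+,−,−)`/`(−,+,+)`) on the side where `f_j` has
      the sign of `a j 0`: `∀ x ∈ (u,v), 0 < a j 0 · (a j 0 + a j 1 x^{d1−d0} + a j 2 x^{d2−d0})`;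
 (C↑) a cloud whose TOP coefficient is isolated (`0 < a j 0·a j 1`, `a j 0·a j 2 < 0`, T4 `(+,+,−)`/`(−,−,+)`) on the side where `f_j` has the sign of
      `a j 2`: `∀ x ∈ (u,v), a j 0 · (…) < 0`;
 (IMG) any row whose stripped form does not vanish and whose order-8 image `ψ₇ − e₁ψ₅ + e₂ψ₃ − e₃ψ₁` (every-K tower at `n = 1`, `eᵢ` of
      `(d1−d0)², (d2−d1)², (d2−d0)²`) is `> 0` on the window — binomial letters get this from ✓⧗ `rowPsiK_image8_single_pos_of_bracket` /
      `rowPsiK_image8_pair_pos_of_bracket` (poles; knees off their ring), further clouds from any other law.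
THEN `#{t ∈ (u,v) : W(∏_j f_j)(t) = 0} ≤ 6` (★★ `sixthOrderCloudCell_wronskian_roots_le_six`).  Proof: the every-K order-6 image cell ✓⧗
`wronskianK_roots_le_six_of_image` at `n = 1` with `k = (d1−d0−1, d2−d1−1, d2−d0−1)`; (C↓)/(C↑) rows are fed by the CLOUD TRANSFER LAWS ✓⧗
`rowPsiK_image8_pos_of_cloud_bottom'` / `rowPsiK_image8_pos_of_cloud_top'` (val-lit-p5 g17).  With E3b (binomial rows) this is the window cell of memo §30.1 (i)
(`ζ_I = 0`) for the floor's one-change companies whose clouds all show their isolated sign on the window; the other cloud sides (switched T5 / flat T4) carry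
the located charges of §30.2 and are NOT covered.

HONEST FRAMING: ONE W-cell (helper); nothing about `WronskianBudgetK3` / `OneChangeFloorK3` / the stubs / 18050 / `MatrixDescartes`; `VP ≠ VNP` is NOT proved.
No definitions, no named facts, no sorry.
-/

set_option linter.dupNamespace false

namespace Summit.ValiantsHypothesis.ValiantsHypothesis.Theorems.LacunarySymmetroidMatrixDescartes

namespace ProductPlusOne

open Finset Set Polynomial
open scoped BigOperators Topology Polynomial

/-- ★★ **THE CLOUD CELL** (K = 3, LINE shape; menu (C↓) / (C↑) / (IMG) of the module docstring): at most SIX roots of `W(∏_j f_j)` in the window.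
[this file's theorem] -/
theorem sixthOrderCloudCell_wronskian_roots_le_six {m : ℕ} (d : Fin 3 → ℕ) (hd : StrictMono d) (h3 : 3 * (d 1 - d 0) ≤ d 2 - d 0)
    (a : Fin m → Fin 3 → ℝ) {u v : ℝ} (hu : 0 < u)
    (hrow : ∀ j,
      (a j 0 * a j 1 < 0 ∧ a j 0 * a j 2 < 0 ∧
          ∀ x ∈ Ioo u v, 0 < a j 0 * (a j 0 + a j 1 * x ^ (d 1 - d 0) + a j 2 * x ^ (d 2 - d 0))) ∨
      (0 < a j 0 * a j 1 ∧ a j 0 * a j 2 < 0 ∧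
          ∀ x ∈ Ioo u v, a j 0 * (a j 0 + a j 1 * x ^ (d 1 - d 0) + a j 2 * x ^ (d 2 - d 0)) < 0) ∨
      (∀ x ∈ Ioo u v, a j 0 + a j 1 * x ^ (d 1 - d 0) + a j 2 * x ^ (d 2 - d 0) ≠ 0 ∧
          0 < rowPsiK7 (fun l : Fin 2 => d l.succ - d 0) (a j 0) (fun l : Fin 2 => -(a j l.succ)) x
            - (((d 1 - d 0 : ℕ) : ℝ) ^ 2 + (((d 2 - d 0 : ℕ) : ℝ) - ((d 1 - d 0 : ℕ) : ℝ)) ^ 2 + ((d 2 - d 0 : ℕ) : ℝ) ^ 2)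
                * rowPsiK5 (fun l : Fin 2 => d l.succ - d 0) (a j 0) (fun l : Fin 2 => -(a j l.succ)) x
            + (((d 1 - d 0 : ℕ) : ℝ) ^ 2 * (((d 2 - d 0 : ℕ) : ℝ) - ((d 1 - d 0 : ℕ) : ℝ)) ^ 2
                  + ((d 1 - d 0 : ℕ) : ℝ) ^ 2 * ((d 2 - d 0 : ℕ) : ℝ) ^ 2
                  + (((d 2 - d 0 : ℕ) : ℝ) - ((d 1 - d 0 : ℕ) : ℝ)) ^ 2 * ((d 2 - d 0 : ℕ) : ℝ) ^ 2)
                * rowPsiK3 (fun l : Fin 2 => d l.succ - d 0) (a j 0) (fun l : Fin 2 => -(a j l.succ)) x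
            - (((d 1 - d 0 : ℕ) : ℝ) ^ 2 * (((d 2 - d 0 : ℕ) : ℝ) - ((d 1 - d 0 : ℕ) : ℝ)) ^ 2 * ((d 2 - d 0 : ℕ) : ℝ) ^ 2)
                * rowPsiK1 (fun l : Fin 2 => d l.succ - d 0) (a j 0) (fun l : Fin 2 => -(a j l.succ)) x)) :
    (((∏ j, ∑ l, C (a j l) * X ^ (d l) : ℝ[X]) * (X * derivative (X * derivative (∏ j, ∑ l, C (a j l) * X ^ (d l) : ℝ[X])))
        - (X * derivative (∏ j, ∑ l, C (a j l) * X ^ (d l) : ℝ[X])) ^ 2).roots.toFinset.filter (fun t => u < t ∧ t < v)).card ≤ 6 := by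
  classical
  have h01 : d 0 < d 1 := hd (by decide)
  have h12 : d 1 < d 2 := hd (by decide)
  have hl0 : 0 < d 1 - d 0 := Nat.sub_pos_of_lt h01
  have hl1 : 3 * (d 1 - d 0) ≤ d 2 - d 0 := h3
  have hl1' : 2 * (d 1 - d 0) ≤ d 2 - d 0 := le_trans (Nat.mul_le_mul_right _ (by norm_num)) h3
  -- the three natural rates `k + 1`
  have hk1 : (((d 1 - d 0 - 1 : ℕ) : ℝ) + 1) = ((d 1 - d 0 : ℕ) : ℝ) := by
    have h : d 1 - d 0 - 1 + 1 = d 1 - d 0 := Nat.sub_add_cancel hl0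
    exact_mod_cast h
  have hk3 : (((d 2 - d 0 - 1 : ℕ) : ℝ) + 1) = ((d 2 - d 0 : ℕ) : ℝ) := by
    have h : d 2 - d 0 - 1 + 1 = d 2 - d 0 := Nat.sub_add_cancel (by omega)
    exact_mod_cast h
  have hk2 : (((d 2 - d 1 - 1 : ℕ) : ℝ) + 1) = ((d 2 - d 0 : ℕ) : ℝ) - ((d 1 - d 0 : ℕ) : ℝ) := by
    have h : d 2 - d 1 - 1 + 1 = d 2 - d 1 := Nat.sub_add_cancel (by omega)
    have h' : ((d 2 - d 1 : ℕ) : ℝ) = ((d 2 - d 0 : ℕ) : ℝ) - ((d 1 - d 0 : ℕ) : ℝ) := by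
      have e : d 2 - d 0 = (d 2 - d 1) + (d 1 - d 0) := by omega
      rw [e]; push_cast; ring
    rw [← h']; exact_mod_cast h
  -- the stripped row in the two spellings
  have hstrip : ∀ j x, a j 0 - ∑ l : Fin 2, (-(a j l.succ)) * x ^ (d l.succ - d 0)
      = a j 0 + a j 1 * x ^ (d 1 - d 0) + a j 2 * x ^ (d 2 - d 0) := by
    intro j x; simp only [Fin.sum_univ_two, Fin.succ_zero_eq_one, Fin.succ_one_eq_two]; ring
  -- every row's image is positive on the window
  have himg : ∀ j, ∀ x ∈ Ioo u v, a j 0 - ∑ l : Fin 2, (-(a j l.succ)) * x ^ (d l.succ - d 0) ≠ 0 ∧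
      0 < rowPsiK7 (fun l : Fin 2 => d l.succ - d 0) (a j 0) (fun l : Fin 2 => -(a j l.succ)) x
        - (((d 1 - d 0 : ℕ) : ℝ) ^ 2 + (((d 2 - d 0 : ℕ) : ℝ) - ((d 1 - d 0 : ℕ) : ℝ)) ^ 2 + ((d 2 - d 0 : ℕ) : ℝ) ^ 2)
            * rowPsiK5 (fun l : Fin 2 => d l.succ - d 0) (a j 0) (fun l : Fin 2 => -(a j l.succ)) x
        + (((d 1 - d 0 : ℕ) : ℝ) ^ 2 * (((d 2 - d 0 : ℕ) : ℝ) - ((d 1 - d 0 : ℕ) : ℝ)) ^ 2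
              + ((d 1 - d 0 : ℕ) : ℝ) ^ 2 * ((d 2 - d 0 : ℕ) : ℝ) ^ 2
              + (((d 2 - d 0 : ℕ) : ℝ) - ((d 1 - d 0 : ℕ) : ℝ)) ^ 2 * ((d 2 - d 0 : ℕ) : ℝ) ^ 2)
            * rowPsiK3 (fun l : Fin 2 => d l.succ - d 0) (a j 0) (fun l : Fin 2 => -(a j l.succ)) x
        - (((d 1 - d 0 : ℕ) : ℝ) ^ 2 * (((d 2 - d 0 : ℕ) : ℝ) - ((d 1 - d 0 : ℕ) : ℝ)) ^ 2 * ((d 2 - d 0 : ℕ) : ℝ) ^ 2)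
            * rowPsiK1 (fun l : Fin 2 => d l.succ - d 0) (a j 0) (fun l : Fin 2 => -(a j l.succ)) x := by
    intro j x hx
    have hx0 : 0 < x := hu.trans hx.1
    rcases hrow j with ⟨h01', h02', hside⟩ | ⟨h01', h02', hside⟩ | hI
    · -- (C↓): the bottom-side cloud transfer law
      have hs := hside x hx
      refine ⟨by rw [hstrip]; intro h0; rw [h0, mul_zero] at hs; exact lt_irrefl _ hs, ?_⟩
      have h := rowPsiK_image8_pos_of_cloud_bottom' (fun l : Fin 2 => d l.succ - d 0) hl0 hl1 (a j 0)
        (fun l : Fin 2 => -(a j l.succ)) hx0 (by simpa using h01') (by simpa using h02')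
        (by simpa [Fin.succ_zero_eq_one, Fin.succ_one_eq_two, sub_neg_eq_add, sub_eq_add_neg] using hs)
      simpa using h
    · -- (C↑): the top-side cloud transfer law
      have hs := hside x hx
      refine ⟨by rw [hstrip]; intro h0; rw [h0, mul_zero] at hs; exact lt_irrefl _ hs, ?_⟩
      have h := rowPsiK_image8_pos_of_cloud_top' (fun l : Fin 2 => d l.succ - d 0) hl0 hl1' (a j 0)
        (fun l : Fin 2 => -(a j l.succ)) hx0 (by simpa using h01') (by simpa using h02')
        (by simpa [Fin.succ_zero_eq_one, Fin.succ_one_eq_two, sub_neg_eq_add, sub_eq_add_neg] using hs)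
      simpa using h
    · exact ⟨by rw [hstrip]; exact (hI x hx).1, (hI x hx).2⟩
  -- the empty company
  rcases Nat.eq_zero_or_pos m with hm | hm
  · subst hm
    simp
  -- the every-K order-6 image cell at `n = 1`
  have hcell := wronskianK_roots_le_six_of_rowImages (n := 1) (v := v) hm d hd a hu (d 1 - d 0 - 1) (d 2 - d 1 - 1) (d 2 - d 0 - 1)
  rw [hk1, hk2, hk3] at hcell
  exact hcell himg

end ProductPlusOne

end Summit.ValiantsHypothesis.ValiantsHypothesis.Theorems.LacunarySymmetroidMatrixDescartes
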